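import Summits.HodgeConjecture.CorCM.IrreducibleOddWeightsAdditivityCriterion
import Summits.HodgeConjecture.CorCM.IrreducibleOddWeightsIndexBound
import Summits.HodgeConjecture.CorCM.IrreducibleOddWeightsCoveringFamily
import HarnessLib

/-!
# Additivity `Hg(∏ A_i) = ∏ Hg(A_i)` is decided on sub-products of at most `q + 1` factors — `q = max_i dim Hg(A_i)`, or
# `q` the index of an abelian subgroup — with no representation listed and degenerate members allowed

COR-CM (cell `pub-hodgecm2`, binder seat `b16` gen 59, count-neutral claim INDEX BOUND, file F8 — abstract `G`-set level;
theorems only, no definition, no named fact, no `sorry`).  NEW as stated, hence under `Summits/`.  HONEST FRAMING: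
unconditional finite-dimensional linear algebra over `ℚ` about the rank of families of CM types, read on Mumford–Tate
groups of products of CM abelian varieties; `HC_CM` is neither used nor asserted.

Sequel of F7 `…AdditivityCriterion` (additive family: `dim U(Σ) = Σ_i dim U(Φ_i)`, i.e. `rank(Σ) − 1 = Σ_i (rank Φ_i − 1)`,
i.e. `Hg(∏_i A_i) = ∏_i Hg(A_i)`; its Helly number for a covering list with `d_k ≤ q δ_k`).  Here the covering list is
removed (F2 `…CoveringFamily`: it exists) and `q` is read off the data:

* §1 DEGREE FORM — **`finrank_antiSpan_sigmaType_eq_sum_iff_forall_card_le_of_finrank_antiSpan_le`**: if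
  `dim U(Φ_i) ≤ q` for all `i` (`dim Hg(A_i) ≤ q`; always `≤ |E_i|/2 = dim A_i`), the family is additive IFF every
  sub-family of at most `q + 1` members is (an irreducible meeting `U(Φ_i)` is a quotient of it: `d_k ≤ q ≤ q δ_k`);
  rank form `typeRank_sigmaType_add_card_eq_iff_forall_card_le_of_typeRank_le` (`rank(Φ_i) ≤ q + 1`).
* §2 INDEX FORM — **`finrank_antiSpan_sigmaType_eq_sum_iff_forall_card_le_index_succ_of_smul_comm`**: `A ≤ G` of finite
  index acting on every slot through pairwise commuting permutations ⟹ sub-families of at most `[G:A] + 1` members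
  decide additivity (F1 `…IndexBound`).
* §3 MINIMAL NON-ADDITIVE FAMILIES — **`card_le_finrank_antiSpan_succ_of_minimal_nonadditive'`**: `|T₀| ≤ dim U(Φ_i) + 1
  = rank(Φ_i)` for every member of a minimal non-additive family (`card_le_typeRank_of_minimal_nonadditive`).

No representation, no CM hypothesis on the members (degenerate types allowed) in the `finrank` forms; the rank forms use
`rank = dim U + 1` (`IsCMTypeWith`).  CM-field dress: F9 `…AdditivityHellyCMFields`.

## References

* [Mai1989] L. Mai, *Lower bounds for the ranks of CM types*, J. Number Theory 32 (1989), §2 Prop. 1 (proof).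
* [MoonenZarhin1999LowDim] B. Moonen, Yu. Zarhin, *Hodge classes on abelian varieties of low dimension*, Math. Ann.
  315 (1999), §3 (3.1).
* [Gordon1999HodgeAVSurvey] B. B. Gordon, *A survey of the Hodge conjecture for abelian varieties*, §3, 7.5–7.7.
* [Serre1977] J.-P. Serre, *Linear Representations of Finite Groups*, GTM 42 (1977), §1.4 Thm. 2, §2.2 Prop. 4, §3.1
  Cor. to Thm. 9.
* [Shimura1998] G. Shimura, *Abelian Varieties with Complex Multiplication and Modular Functions*, §32.10 Prop.
-/

set_option autoImplicit false

noncomputable section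

open scoped BigOperators

universe u u' v w

namespace Summit.HodgeConjecture.CorCM.IrrOdd

open Literature.NumberTheory.ComplexMultiplication

variable {G : Type w} [Group G] {I : Type u} {E : I → Type v} [∀ i, MulAction G (E i)] [Fintype I]
  [∀ i, Fintype (E i)]

/-! ### §0 Rank form versus dimension form -/

/-- `rank(Σ) + |I| = Σ_i rank(Φ_i) + 1 ⟺ dim U(Σ) = Σ_i dim U(Φ_i)` (`rank = dim U + 1` for CM types on non-empty slots).
[cite: Shimura1998, §32.10 Prop.] [cite: Gordon1999HodgeAVSurvey, 7.7] -/
theorem typeRank_sigmaType_add_card_eq_iff_finrank_eq [Nonempty I] [∀ i, Nonempty (E i)] {ρ : G}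
    {Φ : ∀ i, Set (E i)} (h : ∀ i, IsCMTypeWith ρ (Φ i)) :
    typeRank G (sigmaType Φ) + Fintype.card I = (∑ i, typeRank G (Φ i)) + 1 ↔
      Module.finrank ℚ (antiSpan G (sigmaType Φ)) = ∑ i, Module.finrank ℚ (antiSpan G (Φ i)) := by
  obtain ⟨i₀⟩ := ‹Nonempty I›
  haveI : Nonempty (Σ i, E i) := ⟨⟨i₀, Classical.arbitrary (E i₀)⟩⟩
  rw [(IsCMTypeWith.sigmaType h).typeRank_eq_finrank_antiSpan_add_one,
    Finset.sum_congr rfl fun i _ => (h i).typeRank_eq_finrank_antiSpan_add_one, Finset.sum_add_distrib,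
    Finset.sum_const, Finset.card_univ, smul_eq_mul, mul_one]
  omega

/-! ### §1 The degree form: `dim U(Φ_i) ≤ q` for all `i` ⟹ sub-families of at most `q + 1` members decide additivity -/

/-- **ADDITIVITY IS DECIDED ON SUB-FAMILIES OF AT MOST `q + 1` MEMBERS, `q ≥ max_i dim U(Φ_i)`** (any group `G` on finite
slots, ANY subsets `Φ_i` — no CM hypothesis, degenerate types allowed, no representation listed): if `dim U(Φ_i) ≤ q` for
all `i`, then `dim U(Σ) = Σ_i dim U(Φ_i)` (`Hg(∏_i A_i) = ∏_i Hg(A_i)`) IFF every sub-family of at most `q + 1` members is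
additive.  (Covering irreducibles exist, F2; one meeting `U(Φ_i)` is its quotient, `d_k ≤ q`; Helly for additivity, F7.)
[cite: Mai1989, §2 Prop. 1 (proof)] [cite: MoonenZarhin1999LowDim, §3 (3.1)] [cite: Serre1977, §1.4 Thm. 2 and §2.2 Prop. 4] -/
theorem finrank_antiSpan_sigmaType_eq_sum_iff_forall_card_le_of_finrank_antiSpan_le (Φ : ∀ i, Set (E i)) (q : ℕ)
    (hq : ∀ i, Module.finrank ℚ (antiSpan G (Φ i)) ≤ q) :
    Module.finrank ℚ (antiSpan G (sigmaType Φ)) = ∑ i, Module.finrank ℚ (antiSpan G (Φ i)) ↔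
      ∀ T : Finset I, T.card ≤ q + 1 →
        Module.finrank ℚ (antiSpan G (sigmaType fun j : (T : Set I) => Φ j)) =
          ∑ j : (T : Set I), Module.finrank ℚ (antiSpan G (Φ j)) := by
  classical
  obtain ⟨n, S, π, K, hπ, hirr, hne, hcov⟩ := exists_covering_irreducibles_slots (G := G) (E := E)
  let K' : Finset (Fin n) := K.filter fun k => Module.finrank ℚ (S k) ≤ q
  refine finrank_antiSpan_sigmaType_eq_sum_iff_forall_card_le (K := K') (V := fun k : K' => S k.1) Φ (fun k => π k.1)
    (fun k => hirr k.1)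
    (fun k l hkl T => hne k.1 (Finset.mem_filter.1 k.2).1 l.1 (Finset.mem_filter.1 l.2).1
      (fun h' => hkl (Subtype.ext h')) T)
    (fun i P hPU hP0 hPst => ?_) q fun k => ?_
  · obtain ⟨k, hk, T, hT, a, ha, ha0⟩ := hcov i P hP0 hPst
    have hdim : Module.finrank ℚ (S k) ≤ q := by
      haveI := hirr k
      let W : Subrepresentation (π k) := ⟨(antiSpan G (Φ i)).map T, fun g w hw => by
        obtain ⟨b, hb, rfl⟩ := hw
        exact ⟨fun s => b (g⁻¹ • s), comp_smul_mem_antiSpan hb g⁻¹, hT g b⟩⟩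
      rcases (hirr k).eq_bot_or_eq_top W with hW | hW
      · exfalso
        apply ha0
        have hmem : T a ∈ W.toSubmodule := ⟨a, hPU ha, rfl⟩
        rw [hW] at hmem
        exact (Submodule.mem_bot ℚ).1 hmem
      · have htop : (antiSpan G (Φ i)).map T = ⊤ := congrArg Subrepresentation.toSubmodule hW
        calc Module.finrank ℚ (S k) = Module.finrank ℚ (⊤ : Submodule ℚ (S k)) := (finrank_top ℚ (S k)).symm
          _ = Module.finrank ℚ ((antiSpan G (Φ i)).map T) := by rw [htop]
          _ ≤ Module.finrank ℚ (antiSpan G (Φ i)) := Submodule.finrank_map_le T _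
          _ ≤ q := hq i
    exact ⟨⟨k, Finset.mem_filter.2 ⟨hk, hdim⟩⟩, T, hT, a, ha, ha0⟩
  · have hδ := finrank_intertwiningMap_pos (π k.1) (hirr k.1)
    calc Module.finrank ℚ (S k.1) ≤ q := (Finset.mem_filter.1 k.2).2
      _ ≤ q * Module.finrank ℚ ((π k.1).IntertwiningMap (π k.1)) := Nat.le_mul_of_pos_right q hδ

/-- **Half the largest slot always works**: `dim U(Φ_i) ≤ |E_i|/2` for a CM type (Shimura), so additivity of a family of CM
types on slots of size `≤ 2q` is decided on sub-families of at most `q + 1` members — on Mumford–Tate groups: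
`Hg(∏_i A_i) = ∏_i Hg(A_i)` iff so on all sub-products of at most `max_i dim A_i + 1` factors, degenerate `A_i` allowed.
[cite: Shimura1998, §32.10 Prop.] [cite: Mai1989, §2 Prop. 1 (proof)] [cite: MoonenZarhin1999LowDim, §3 (3.1)] -/
theorem finrank_antiSpan_sigmaType_eq_sum_iff_forall_card_le_half_card_succ [∀ i, Nonempty (E i)] {ρ : G}
    {Φ : ∀ i, Set (E i)} (h : ∀ i, IsCMTypeWith ρ (Φ i)) (q : ℕ) (hq : ∀ i, Fintype.card (E i) ≤ 2 * q) :
    Module.finrank ℚ (antiSpan G (sigmaType Φ)) = ∑ i, Module.finrank ℚ (antiSpan G (Φ i)) ↔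
      ∀ T : Finset I, T.card ≤ q + 1 →
        Module.finrank ℚ (antiSpan G (sigmaType fun j : (T : Set I) => Φ j)) =
          ∑ j : (T : Set I), Module.finrank ℚ (antiSpan G (Φ j)) :=
  finrank_antiSpan_sigmaType_eq_sum_iff_forall_card_le_of_finrank_antiSpan_le Φ q fun i => by
    have h1 := (h i).typeRank_eq_finrank_antiSpan_add_one (G := G)
    have h2 := (h i).typeRank_le (G := G)
    have h3 := hq i
    omega

/-- **Rank form of the degree bound**: `rank(Φ_i) ≤ q + 1` for all `i` (`dim MT(A_i) ≤ q + 1`, i.e. `dim Hg(A_i) ≤ q`)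
⟹ `rank(Σ) + |I| = Σ_i rank(Φ_i) + 1` IFF `rank(Σ|_T) − 1 = Σ_{j∈T} (rank(Φ_j) − 1)` for every non-empty `T` with
`|T| ≤ q + 1`. [cite: Mai1989, §2 Prop. 1 (proof)] [cite: MoonenZarhin1999LowDim, §3 (3.1)] [cite: Gordon1999HodgeAVSurvey, 7.7] -/
theorem typeRank_sigmaType_add_card_eq_iff_forall_card_le_of_typeRank_le [Nonempty I] [∀ i, Nonempty (E i)] {ρ : G}
    {Φ : ∀ i, Set (E i)} (h : ∀ i, IsCMTypeWith ρ (Φ i)) (q : ℕ) (hq : ∀ i, typeRank G (Φ i) ≤ q + 1) :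
    typeRank G (sigmaType Φ) + Fintype.card I = (∑ i, typeRank G (Φ i)) + 1 ↔
      ∀ T : Finset I, T.Nonempty → T.card ≤ q + 1 →
        Module.finrank ℚ (antiSpan G (sigmaType fun j : (T : Set I) => Φ j)) =
          ∑ j : (T : Set I), Module.finrank ℚ (antiSpan G (Φ j)) := by
  rw [typeRank_sigmaType_add_card_eq_iff_finrank_eq h,
    finrank_antiSpan_sigmaType_eq_sum_iff_forall_card_le_of_finrank_antiSpan_le Φ q fun i => by
      have h1 := (h i).typeRank_eq_finrank_antiSpan_add_one (G := G); have h2 := hq i; omega]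
  refine ⟨fun H T _ hT => H T hT, fun H T hT => ?_⟩
  by_cases hTne : T.Nonempty
  · exact H T hTne hT
  · rw [Finset.not_nonempty_iff_eq_empty.1 hTne]
    haveI : IsEmpty ((∅ : Finset I) : Set I) := by simp
    rw [Fintype.sum_empty]
    have h0 : antiSpan G (sigmaType fun j : ((∅ : Finset I) : Set I) => Φ j) = ⊥ := by
      rw [Submodule.eq_bot_iff]
      intro f _
      funext x
      exact isEmptyElim x.1
    rw [h0, finrank_bot]

/-! ### §2 The index form: a finite-index subgroup acting through commuting permutations -/

/-- **ADDITIVITY IS DECIDED ON SUB-FAMILIES OF AT MOST `[G : A] + 1` MEMBERS** for `A ≤ G` of finite index whose elements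
act on every slot through pairwise commuting permutations (e.g. `A` abelian); any subsets `Φ_i`, degenerate types
allowed, no representation listed (F2 covering, F1 `d_k ≤ [G:A] δ_k`, F7 Helly for additivity).
[cite: Serre1977, §3.1 Cor. to Thm. 9] [cite: Mai1989, §2 Prop. 1 (proof)] [cite: MoonenZarhin1999LowDim, §3 (3.1)] -/
theorem finrank_antiSpan_sigmaType_eq_sum_iff_forall_card_le_index_succ_of_smul_comm (Φ : ∀ i, Set (E i))
    (A : Subgroup G) [A.FiniteIndex] (hA : ∀ a ∈ A, ∀ b ∈ A, ∀ (i : I) (s : E i), a • b • s = b • a • s) :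
    Module.finrank ℚ (antiSpan G (sigmaType Φ)) = ∑ i, Module.finrank ℚ (antiSpan G (Φ i)) ↔
      ∀ T : Finset I, T.card ≤ A.index + 1 →
        Module.finrank ℚ (antiSpan G (sigmaType fun j : (T : Set I) => Φ j)) =
          ∑ j : (T : Set I), Module.finrank ℚ (antiSpan G (Φ j)) := by
  classical
  obtain ⟨n, S, π, K, hπ, hirr, hne, hcov⟩ := exists_covering_irreducibles_slots (G := G) (E := E)
  refine finrank_antiSpan_sigmaType_eq_sum_iff_forall_card_le (K := K) (V := fun k : K => S k.1) Φ (fun k => π k.1)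
    (fun k => hirr k.1) (fun k l hkl T => hne k.1 k.2 l.1 l.2 (fun h' => hkl (Subtype.ext h')) T)
    (fun i P _ hP0 hPst => ?_) A.index fun k =>
      finrank_le_index_mul_finrank_intertwiningMap (π k.1) (hirr k.1) A (commute_of_smul_comm (π k.1) (hπ k.1) A hA)
  obtain ⟨k, hk, T, hT, a, ha, ha0⟩ := hcov i P hP0 hPst
  exact ⟨⟨k, hk⟩, T, hT, a, ha, ha0⟩

/-- **Commuting permutations (abelian image): PAIRS DECIDE ADDITIVITY** — `Hg(∏_i A_i) = ∏_i Hg(A_i)` iff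
`Hg(A_i × A_j) = Hg(A_i) × Hg(A_j)` for all `i, j`, degenerate members allowed.
[cite: Serre1977, §3.1 Thm. 9] [cite: Gordon1999HodgeAVSurvey, 7.5–7.7] [cite: MoonenZarhin1999LowDim, §3 (3.1)] -/
theorem finrank_antiSpan_sigmaType_eq_sum_iff_forall_card_le_two_of_smul_comm (Φ : ∀ i, Set (E i))
    (hG : ∀ (a b : G) (i : I) (s : E i), a • b • s = b • a • s) :
    Module.finrank ℚ (antiSpan G (sigmaType Φ)) = ∑ i, Module.finrank ℚ (antiSpan G (Φ i)) ↔
      ∀ T : Finset I, T.card ≤ 2 →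
        Module.finrank ℚ (antiSpan G (sigmaType fun j : (T : Set I) => Φ j)) =
          ∑ j : (T : Set I), Module.finrank ℚ (antiSpan G (Φ j)) := by
  have h := finrank_antiSpan_sigmaType_eq_sum_iff_forall_card_le_index_succ_of_smul_comm Φ (⊤ : Subgroup G)
    fun a _ b _ i s => hG a b i s
  rwa [Subgroup.index_top] at h

/-! ### §3 Minimal non-additive families -/

/-- **`|T₀| ≤ dim U(Φ_i) + 1` FOR EVERY MEMBER OF A MINIMAL NON-ADDITIVE FAMILY — no representation listed, degenerate
members allowed**: if `T₀` is non-additive while all its proper sub-families are additive, then for every `i ∈ T₀`,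
`|T₀| ≤ dim U(Φ_i) + 1` (F2 covering + F7 §3). [cite: Mai1989, §2 Prop. 1 (proof)] [cite: Serre1977, §1.4 Thm. 2 and §2.2 Prop. 4]
[cite: MoonenZarhin1999LowDim, §3 (3.1)] -/
theorem card_le_finrank_antiSpan_succ_of_minimal_nonadditive' (Φ : ∀ i, Set (E i)) (T₀ : Finset I)
    (hnot : Module.finrank ℚ (antiSpan G (sigmaType fun j : (T₀ : Set I) => Φ j)) ≠
      ∑ j : (T₀ : Set I), Module.finrank ℚ (antiSpan G (Φ j)))
    (hmin : ∀ T : Finset I, T ⊂ T₀ →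
      Module.finrank ℚ (antiSpan G (sigmaType fun j : (T : Set I) => Φ j)) =
        ∑ j : (T : Set I), Module.finrank ℚ (antiSpan G (Φ j)))
    {i : I} (hi : i ∈ T₀) : T₀.card ≤ Module.finrank ℚ (antiSpan G (Φ i)) + 1 := by
  classical
  obtain ⟨n, S, π, K, -, hirr, hne, hcov⟩ := exists_covering_irreducibles_slots (G := G) (E := E)
  refine card_le_finrank_antiSpan_succ_of_minimal_nonadditive (K := K) (V := fun k : K => S k.1) Φ (fun k => π k.1)
    (fun k => hirr k.1) (fun k l hkl T => hne k.1 k.2 l.1 l.2 (fun h' => hkl (Subtype.ext h')) T)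
    (fun i P _ hP0 hPst => ?_) T₀ hnot hmin hi
  obtain ⟨k, hk, T, hT, a, ha, ha0⟩ := hcov i P hP0 hPst
  exact ⟨⟨k, hk⟩, T, hT, a, ha, ha0⟩

/-- **Rank form: `|T₀| ≤ rank(Φ_i)` for every member of a minimal non-additive family of CM types** (`rank = dim U + 1`;
on Mumford–Tate groups: `|T₀| ≤ dim MT(A_i) = dim Hg(A_i) + 1`). [cite: Shimura1998, §32.10 Prop.]
[cite: Mai1989, §2 Prop. 1 (proof)] [cite: MoonenZarhin1999LowDim, §3 (3.1)] -/
theorem card_le_typeRank_of_minimal_nonadditive [∀ i, Nonempty (E i)] {ρ : G} {Φ : ∀ i, Set (E i)}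
    (h : ∀ i, IsCMTypeWith ρ (Φ i)) (T₀ : Finset I)
    (hnot : Module.finrank ℚ (antiSpan G (sigmaType fun j : (T₀ : Set I) => Φ j)) ≠
      ∑ j : (T₀ : Set I), Module.finrank ℚ (antiSpan G (Φ j)))
    (hmin : ∀ T : Finset I, T ⊂ T₀ →
      Module.finrank ℚ (antiSpan G (sigmaType fun j : (T : Set I) => Φ j)) =
        ∑ j : (T : Set I), Module.finrank ℚ (antiSpan G (Φ j)))
    {i : I} (hi : i ∈ T₀) : T₀.card ≤ typeRank G (Φ i) := by
  rw [(h i).typeRank_eq_finrank_antiSpan_add_one]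
  exact card_le_finrank_antiSpan_succ_of_minimal_nonadditive' Φ T₀ hnot hmin hi

end Summit.HodgeConjecture.CorCM.IrrOdd

end
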